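import Summits.QuantumFields.YangMills.Theorems.BalabanUVNodesN19TargetOfDecorrelationReading

/-!
# YM-DAG node N19 (= NE7 proper) — THE LOGICAL GEOGRAPHY OF THE RESPONSE-MATCHING ∕ DECORRELATION ROAD: the road CONTAINS the `Core` road (all classes good:
# `Core δ ⇒ (RM) 2vol·δ ∧ (DC) 2vol·δ ⇒ Target 4vol·δ`), and BOTH of its letters are load-bearing — kernel witnesses of «(RM) exact ∧ ¬Target» (so (DC) is NOT
# idle) and «(DC) exact ∧ ¬Target» (so (RM) is NOT idle); with FILE D §1 («Target ∧ ¬Core») the four corners are inhabited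

Cell `pub-ymgap`, HUMAN RULING D-0062 (Track A), width seat `pub-ymgap-dag-n19-w2` (node n19 = NE7), generation g7 (R455 (A) rule (ii); CLAIM-7 on the cell
bus).  Route `Summits/QuantumFields/YangMills/Theses/BalabanUVNodes.lean`, key item K3⁸ `SpineGivenEndpointR13SepCoPHV` (stmt-QuantumFields-27366; aside
predecessor K3⁷ 20544); filed `--kind proof --supports … --as helper`.  COUNT-NEUTRAL.  THEOREMS ONLY (0 `def`, 0 `sorry`).  ADDITIVE — imports this seat's
FILE C `…N19TargetOfDecorrelationReading` (p625854: `abs_genFunIncr_sub_le_of_response_decorrelation`, `decorrelation_of_classBlindContrast`,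
`matchingModConstants_of_responseDecorrelationReading`) and through it dag-n19-e's `…N19CoreMetric` (`exists_target_iff_summable_genFun_increments`,
`matchingModConstants_of_genFun_increments`, `abs_log_sub_log_sub_le_of_sandwich`) and `Spine/NE7/Targets` (`Core`, `Target`); modifies nothing.

WHY (A6 ∕ A2 hygiene for the road, asked of myself before a referee asks).  FILE C reads node U5's `Target` from (RM) + (DC).  Three questions: (a) does the
road LOSE anything against the `Core` road? — no: with all classes good, `Core … δ` gives (RM) with `r_K = 2vol·δ_K` (the constant cancels between `t` and
`0`) and (DC) with `κ_K = 2vol·δ_K` (the contrast is class-blind at source `0`, FILE C's `decorrelation_of_classBlindContrast`), hence `Target vol l₀ (4δ) Z`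
(§1) — the road contains the `Core` road and, by FILE D §1, strictly more; (b) is (DC) IDLE given (RM)? — no: §2's two-class reading has EXACT response
matching at every `K` and NO `Target` for any `vol`, `δ` (the contrast loads the source-feeling class with a weight oscillating in `K`, so the class-mean of
the response oscillates: `Z K t = 1 − p_K + p_K e^{t}`, `p_K ∈ {1∕4, 3∕4}` by parity); (c) is (RM) IDLE given (DC)? — no: §3's ONE-class reading has (DC) with
`κ = 0` trivially and NO `Target` (`Z K t = e^{tK}`, increments `t`).  So both letters carry weight, and neither is the other in disguise.

WHAT IS KERNEL-CHECKED ([folklore] finite sums; tree lemmas BY NAME).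
* §1 `responseMatching_of_core` ((RM) with `2vol·δ_K` from `Core`, all classes good) · `decorrelation_of_core` ((DC) with `2vol·δ_K`) ·
  ★ `target_of_core_allGood` (`Core l₀ vol T ∅ A B δ`, positivity, dictionary, `Summable δ`, `0 ≤ l₀` ⇒ `Target vol l₀ (4·δ) Z` THROUGH THE ROAD).
* §2 ★★ `toyRM_responseMatching` ∧ `toyRM_not_target` — (RM) exact, `¬ ∃ vol δ, Target vol l₀ δ Z` (`0 < l₀`): (DC) is load-bearing.
* §3 ★ `toyDC_decorrelation` ∧ `toyDC_not_target` — one class ((DC) exact), `¬ ∃ vol δ, Target vol l₀ δ Z` (`0 < l₀`): (RM) is load-bearing.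
* §4 `target_of_sourceBlind` — a source-blind `Z` (`Z K t = Z K 0`) has `Target vol l₀ 0 Z`: the window-key-core caricature (both cores `t`-free) kills the
  `Core` edge yet meets the node's target trivially — a caricature testing the TARGET must correlate a source response with the old-block contrast (§2).
* helpers `not_summable_of_le_const` (a sequence bounded below by a positive constant is not summable), `toyRM_dictionary`.

HONEST FRAMING.  Toys and elementary implications on hypothesis SHAPES; nothing of Bałaban's instantiated; NE7 NOT PRINTED for d = 4 ∕ NOT proved; N19 NOT
discharged; K3⁸ 27366 OPEN, not claimed — stub 2 is `Core`-typed and NOT served here; counts UNMOVED (typed 28∕28 · discharged 5∕27, A 5∕28); no count claim.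
One finite four-torus programme at fixed ε; R4 closes the conditional finite-𝕋⁴ rung `BalabanLadder.UV` only — NOT the Yang–Mills mass gap, NOT the Clay
problem.  0 `def`; 0 `sorry`; standard axioms.
-/

noncomputable section

open Finset Filter Topology
open scoped BigOperators

namespace Summit.QuantumFields.YangMills.BalabanUVNodes.N19ResponseRoadGeography

open Literature.MathematicalPhysics.QuantumFieldTheory.Balaban1983to89.T4CauchySum (MatchingModConstants genFun)
open Summit.QuantumFields.BalabanUV.T4Continuum.Spine
open Summit.QuantumFields.YangMills.BalabanUVNodes.N19CoreMetric (exists_target_iff_summable_genFun_increments abs_log_sub_log_sub_le_of_sandwich)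
open Summit.QuantumFields.YangMills.BalabanUVNodes.N19TargetOfDecorrelationReading

variable {ι : Type*}

/-! ## §1 The road contains the `Core` road (all classes good) -/

section FromCore

variable [DecidableEq ι] {l₀ vol : ℝ} {T : ℕ → Finset ι} {A B : ℕ → ℝ → ι → ℝ} {δ : ℕ → ℝ}

/-- **`Core` ⇒ (RM)** with radius `2·vol·δ_K` (all classes good, positive run-A weights, `0 ≤ l₀`): the class-uniform constant CANCELS between source `t` and
source `0` (n19-e's `abs_log_sub_log_sub_le_of_sandwich` at `t` and at `0`). [folklore] -/
theorem responseMatching_of_core (hC : NE7.Core l₀ vol T (fun _ _ => ∅) A B δ) (hl₀ : 0 ≤ l₀)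
    (hA : ∀ K t, |t| ≤ l₀ → ∀ τ ∈ T K, 0 < A K t τ) (K : ℕ) {t : ℝ} (ht : |t| ≤ l₀) {τ : ι} (hτ : τ ∈ T K) :
    |(Real.log (B K t τ) - Real.log (B K 0 τ)) - (Real.log (A K t τ) - Real.log (A K 0 τ))| ≤ 2 * (vol * δ K) := by
  have h0 : |(0 : ℝ)| ≤ l₀ := by simpa using hl₀
  obtain ⟨c, hc⟩ := hC K
  have hgood : ∀ s, τ ∈ T K \ (fun (_ : ℕ) (_ : ℝ) => (∅ : Finset ι)) K s := fun s => by simpa using hτ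
  have ht' := abs_log_sub_log_sub_le_of_sandwich (hA K t ht τ hτ) (hc t ht τ (hgood t)).1 (hc t ht τ (hgood t)).2
  have h0' := abs_log_sub_log_sub_le_of_sandwich (hA K 0 h0 τ hτ) (hc 0 h0 τ (hgood 0)).1 (hc 0 h0 τ (hgood 0)).2
  rw [abs_le] at ht' h0' ⊢
  constructor <;> linarith [ht'.1, ht'.2, h0'.1, h0'.2]

/-- **`Core` ⇒ (DC)** with radius `2·vol·δ_K`: at source `0` the contrast is class-blind about `c_K` up to `vol·δ_K`, and FILE C's
`decorrelation_of_classBlindContrast` applies. [folklore] -/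
theorem decorrelation_of_core (hC : NE7.Core l₀ vol T (fun _ _ => ∅) A B δ) (hl₀ : 0 ≤ l₀) (hT : ∀ K, (T K).Nonempty)
    (hA : ∀ K t, |t| ≤ l₀ → ∀ τ ∈ T K, 0 < A K t τ) (hB : ∀ K t, |t| ≤ l₀ → ∀ τ ∈ T K, 0 < B K t τ)
    (K : ℕ) {t : ℝ} (ht : |t| ≤ l₀) :
    |Real.log (∑ τ ∈ T K, B K 0 τ * (A K t τ / A K 0 τ)) - Real.log (∑ τ ∈ T K, B K 0 τ) -
        (Real.log (∑ τ ∈ T K, A K t τ) - Real.log (∑ τ ∈ T K, A K 0 τ))| ≤ 2 * (vol * δ K) := by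
  have h0 : |(0 : ℝ)| ≤ l₀ := by simpa using hl₀
  obtain ⟨c, hc⟩ := hC K
  have hgood : ∀ {τ}, τ ∈ T K → τ ∈ T K \ (fun (_ : ℕ) (_ : ℝ) => (∅ : Finset ι)) K 0 := fun hτ => by simpa using hτ
  exact decorrelation_of_classBlindContrast (A := A K) (B := B K) (hT K) (hA K) (fun τ hτ => hB K 0 h0 τ hτ) hl₀ (c := c)
    (fun τ hτ => abs_log_sub_log_sub_le_of_sandwich (hA K 0 h0 τ hτ) (hc 0 h0 τ (hgood hτ)).1 (hc 0 h0 τ (hgood hτ)).2) ht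

/-- **THE ROAD CONTAINS THE `Core` ROAD** (all classes good): `Core l₀ vol T ∅ A B δ` + positivity + the dictionary + `Summable δ` ⇒ `Target vol l₀ (4·δ) Z`, through
(RM) and (DC) of radius `2vol·δ_K` each (FILE C's `matchingModConstants_of_responseDecorrelationReading`).  FILE D §1 shows the containment is STRICT. [folklore] -/
theorem target_of_core_allGood {Z : ℕ → ℝ → ℝ} (hC : NE7.Core l₀ vol T (fun _ _ => ∅) A B δ) (hl₀ : 0 ≤ l₀) (hT : ∀ K, (T K).Nonempty)
    (hA : ∀ K t, |t| ≤ l₀ → ∀ τ ∈ T K, 0 < A K t τ) (hB : ∀ K t, |t| ≤ l₀ → ∀ τ ∈ T K, 0 < B K t τ)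
    (hZA : ∀ K t, |t| ≤ l₀ → Z K t = ∑ τ ∈ T K, A K t τ) (hZB : ∀ K t, |t| ≤ l₀ → Z (K + 1) t = ∑ τ ∈ T K, B K t τ) (hδ : Summable δ) :
    NE7.Target vol l₀ (fun K => 4 * δ K) Z :=
  ⟨matchingModConstants_of_responseDecorrelationReading hl₀ T A B (fun K => 2 * (vol * δ K)) (fun K => 2 * (vol * δ K)) hT hA hB
      (fun K t ht τ hτ => responseMatching_of_core hC hl₀ hA K ht hτ) (fun K t ht => decorrelation_of_core hC hl₀ hT hA hB K ht) hZA hZB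
      (fun K => by ring_nf; exact le_rfl),
    hδ.mul_left 4⟩

end FromCore

/-! ## §2 (DC) is load-bearing: exact response matching, no `Target` -/

section ToyRM

/-- A real sequence bounded below by a positive constant is not summable. [folklore] -/
theorem not_summable_of_le_const {D : ℕ → ℝ} {c : ℝ} (hc : 0 < c) (h : ∀ K, c ≤ D K) : ¬ Summable D := by
  intro hD
  have h0 := hD.tendsto_atTop_zero
  have hev : ∀ᶠ K in atTop, D K < c := h0.eventually (gt_mem_nhds hc)
  obtain ⟨K, hK⟩ := hev.exists
  exact absurd (h K) (not_le.2 hK)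

/-- the oscillating load `p_K = 1∕4` (even `K`), `3∕4` (odd `K`). -/
private theorem p_bounds (K : ℕ) : 0 < (if Even K then (1 : ℝ) / 4 else 3 / 4) ∧ (if Even K then (1 : ℝ) / 4 else 3 / 4) < 1 := by
  split_ifs <;> constructor <;> norm_num

/-- **TOY (RM): EXACT RESPONSE MATCHING.**  Classes `Bool`; run A at pair `K`: class `false` weighs `1 − p_K` at every source (source-blind), class `true` weighs
`p_K·e^{t}` (source-feeling); run B the same with `p_{K+1}` — so `B_t∕B_0 = A_t∕A_0` in EVERY class ((RM) with `r = 0`), while the two-run contrast moves weight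
between the source-blind and the source-feeling class. [folklore] -/
theorem toyRM_responseMatching (K : ℕ) (t : ℝ) (τ : Bool) :
    (Real.log ((fun (K : ℕ) (t : ℝ) (τ : Bool) => bif τ then (if Even K then (1 : ℝ) / 4 else 3 / 4) * Real.exp t
        else 1 - (if Even K then (1 : ℝ) / 4 else 3 / 4)) (K + 1) t τ) -
      Real.log ((fun (K : ℕ) (t : ℝ) (τ : Bool) => bif τ then (if Even K then (1 : ℝ) / 4 else 3 / 4) * Real.exp t
        else 1 - (if Even K then (1 : ℝ) / 4 else 3 / 4)) (K + 1) 0 τ)) -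
    (Real.log ((fun (K : ℕ) (t : ℝ) (τ : Bool) => bif τ then (if Even K then (1 : ℝ) / 4 else 3 / 4) * Real.exp t
        else 1 - (if Even K then (1 : ℝ) / 4 else 3 / 4)) K t τ) -
      Real.log ((fun (K : ℕ) (t : ℝ) (τ : Bool) => bif τ then (if Even K then (1 : ℝ) / 4 else 3 / 4) * Real.exp t
        else 1 - (if Even K then (1 : ℝ) / 4 else 3 / 4)) K 0 τ)) = 0 := by
  cases τ
  · simp
  · simp only [cond_true]
    have h1 := (p_bounds (K + 1)).1
    have h2 := (p_bounds K).1
    rw [Real.log_mul h1.ne' (Real.exp_pos t).ne', Real.log_mul h1.ne' (Real.exp_pos 0).ne',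
      Real.log_mul h2.ne' (Real.exp_pos t).ne', Real.log_mul h2.ne' (Real.exp_pos 0).ne']
    ring

/-- **TOY (RM): NO TARGET.**  The dressed partition functions of the toy are `Z K t = 1 − p_K + p_K e^{t}` (`= Σ_T A K t = Σ_T B (K−1) t`): the generating-function
increment at `t = l₀ > 0` is `±(log(¼ + ¾e^{l₀}) − log(¾ + ¼e^{l₀})) ≠ 0` at EVERY `K`, so `¬ ∃ vol δ, Target vol l₀ δ Z` (n19-e's
`exists_target_iff_summable_genFun_increments`).  With `toyRM_responseMatching`: (RM) alone does not give the node's target — (DC) is load-bearing. [folklore] -/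
theorem toyRM_not_target {l₀ : ℝ} (hl₀ : 0 < l₀) :
    ¬ ∃ (vol : ℝ) (δ : ℕ → ℝ), NE7.Target vol l₀ δ
      (fun K t => 1 - (if Even K then (1 : ℝ) / 4 else 3 / 4) + (if Even K then (1 : ℝ) / 4 else 3 / 4) * Real.exp t) := by
  rw [exists_target_iff_summable_genFun_increments hl₀.le]
  rintro ⟨D, hD, hincr⟩
  -- the increment at `t = l₀`
  set E : ℝ := Real.exp l₀ with hE
  have hE1 : 1 < E := by rw [hE]; exact Real.one_lt_exp_iff.2 hl₀
  set c : ℝ := Real.log (1 / 4 + 3 / 4 * E) - Real.log (3 / 4 + 1 / 4 * E) with hc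
  have hlo : 0 < 3 / 4 + 1 / 4 * E := by positivity
  have hhi : 3 / 4 + 1 / 4 * E < 1 / 4 + 3 / 4 * E := by linarith
  have hcpos : 0 < c := by rw [hc]; exact sub_pos.2 (Real.log_lt_log hlo hhi)
  refine not_summable_of_le_const hcpos (fun K => ?_) hD
  have h := hincr K l₀ (by rw [abs_of_pos hl₀])
  -- compute the generating functions
  have hgen : ∀ K : ℕ, genFun (fun K t => 1 - (if Even K then (1 : ℝ) / 4 else 3 / 4) + (if Even K then (1 : ℝ) / 4 else 3 / 4) * Real.exp t) K l₀ =
      Real.log (1 - (if Even K then (1 : ℝ) / 4 else 3 / 4) + (if Even K then (1 : ℝ) / 4 else 3 / 4) * E) := by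
    intro K; simp [genFun, hE]
  rw [hgen, hgen] at h
  rcases Nat.even_or_odd K with hK | hK
  · have hK1 : ¬ Even (K + 1) := Nat.not_even_iff_odd.2 (Even.add_one hK)
    simp only [hK, hK1, if_true, if_false] at h
    have e : Real.log (1 - 3 / 4 + 3 / 4 * E) - Real.log (1 - 1 / 4 + 1 / 4 * E) = c := by rw [hc]; norm_num
    rw [e, abs_of_pos hcpos] at h
    exact h
  · have hK0 : ¬ Even K := Nat.not_even_iff_odd.2 hK
    have hK1 : Even (K + 1) := Odd.add_one hK
    simp only [hK0, hK1, if_true, if_false] at h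
    have e : Real.log (1 - 1 / 4 + 1 / 4 * E) - Real.log (1 - 3 / 4 + 3 / 4 * E) = -c := by rw [hc]; norm_num
    rw [e, abs_neg, abs_of_pos hcpos] at h
    exact h

/-- … and the toy's reading obeys the dictionary: `Σ_{Bool} A K t = Z K t` and `Σ_{Bool} B K t = Σ_{Bool} A (K+1) t = Z (K+1) t` (so `toyRM_not_target` IS about the
totals of `toyRM_responseMatching`'s classes). [folklore] -/
theorem toyRM_dictionary (K : ℕ) (t : ℝ) :
    ∑ τ : Bool, (bif τ then (if Even K then (1 : ℝ) / 4 else 3 / 4) * Real.exp t else 1 - (if Even K then (1 : ℝ) / 4 else 3 / 4)) =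
      1 - (if Even K then (1 : ℝ) / 4 else 3 / 4) + (if Even K then (1 : ℝ) / 4 else 3 / 4) * Real.exp t := by
  rw [Fintype.sum_bool, cond_true, cond_false]; ring

end ToyRM

/-! ## §3 (RM) is load-bearing: one class ((DC) exact), no `Target` -/

section ToyDC

/-- **TOY (DC): ONE CLASS.**  With a single class the decorrelation letter holds EXACTLY (both means are the one response): FILE C's (DC)-expression vanishes for
any positive weights on `Unit`. [folklore] -/
theorem toyDC_decorrelation (A B : ℝ → Unit → ℝ) (hA : ∀ s u, 0 < A s u) (hB : ∀ u, 0 < B 0 u) (t : ℝ) :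
    Real.log (∑ τ : Unit, B 0 τ * (A t τ / A 0 τ)) - Real.log (∑ τ : Unit, B 0 τ) -
        (Real.log (∑ τ : Unit, A t τ) - Real.log (∑ τ : Unit, A 0 τ)) = 0 := by
  simp only [Finset.univ_unique, Finset.sum_singleton]
  rw [Real.log_mul (hB _).ne' (div_pos (hA t _) (hA 0 _)).ne', Real.log_div (hA t _).ne' (hA 0 _).ne']
  ring

/-- **TOY (DC): NO TARGET.**  `Z K t = e^{tK}` (one class; run A at pair `K` = `Z K`, run B = `Z (K+1)`): the increment of the generating functions at `t = l₀ > 0` is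
`l₀` at every `K` — (RM) fails with `r_K = l₀`, not summable — and `¬ ∃ vol δ, Target vol l₀ δ Z`.  With `toyDC_decorrelation`: (DC) alone does not give the
node's target — (RM) is load-bearing. [folklore] -/
theorem toyDC_not_target {l₀ : ℝ} (hl₀ : 0 < l₀) :
    ¬ ∃ (vol : ℝ) (δ : ℕ → ℝ), NE7.Target vol l₀ δ (fun K t => Real.exp (t * K)) := by
  rw [exists_target_iff_summable_genFun_increments hl₀.le]
  rintro ⟨D, hD, hincr⟩
  refine not_summable_of_le_const hl₀ (fun K => ?_) hD
  have h := hincr K l₀ (by rw [abs_of_pos hl₀])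
  simp only [genFun, Real.log_exp, zero_mul, Nat.cast_add, Nat.cast_one] at h
  have e : l₀ * (↑K + 1) - 0 - (l₀ * ↑K - 0) = l₀ := by ring
  rw [e, abs_of_pos hl₀] at h
  exact h

end ToyDC

/-! ## §4 Source-blind readings meet the node's `Target` trivially — the window-key-core caricature tests the `Core` ROAD, not the TARGET -/

section SourceBlind

/-- **A SOURCE-BLIND SEQUENCE HAS THE TARGET WITH ZERO REMAINDER.**  If `Z K t = Z K 0` on `|t| ≤ l₀` for every `K` (neither run feels the source), then
`NE7.Target vol l₀ 0 Z` for every `vol` (constants `log Z_{K+1}(0) − log Z_K(0)`, remainder `0`).  The crux card window-key-core's caricature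
(`Cruxes/…/WindowKeyCoreSketch.lean` §1: run A's core `≡ 1`, run B's `exp(c_K + D·v)`, both `t`-free) is source-blind: it refutes the `Core` ∃δ-edge
(`caricature_not_coreEdge`) while any source-blind dictionary over it meets node U5's target trivially — a caricature that tests the TARGET must give the
classes a source RESPONSE and correlate it with the old-block contrast (§2's mechanism); absent such a correlation ((MIX)+(LOC) of FILES G∕H) there is
no obstruction. [folklore] -/
theorem target_of_sourceBlind {vol l₀ : ℝ} {Z : ℕ → ℝ → ℝ} (hZ : ∀ (K : ℕ) (t : ℝ), |t| ≤ l₀ → Z K t = Z K 0) :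
    NE7.Target vol l₀ (fun _ => 0) Z := by
  refine ⟨fun K => ⟨Real.log (Z (K + 1) 0) - Real.log (Z K 0), fun t ht => ?_⟩, summable_zero⟩
  rw [hZ (K + 1) t ht, hZ K t ht]
  simp

end SourceBlind

end Summit.QuantumFields.YangMills.BalabanUVNodes.N19ResponseRoadGeography

end
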